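import Summits.QuantumFields.YangMills.Theorems.FluctuationComparisonRegPrIntLRunPairOrganFiniteChainCore
import Literature.MathematicalPhysics.QuantumFieldTheory.Balaban1983to89.T3NestedUnitLaws
import HarnessLib

/-!
# Crux `FluctuationComparisonRegPrIntL` (stmt-QuantumFields-20520), LINE «run-pair organ» (ym-r3-idea-1 g15, skeleton v5/v6) —
# the FINITE BACKWARD CHAIN «FC» (`stub_finiteChain`), with its indexing repaired

The skeleton `Cruxes/FluctuationComparisonRegPrIntL/Lines/runpair_organ.lean` (v5/v6) cuts the uniform finite-run organ S3
`BackwardStabilityFin` into the local one-step organ O1 `OneStepContractionRun` and the finite chain FC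
`stub_finiteChain : OneStepContractionRun → BackwardStabilityFin` («M; adapt p660990»).

FINDING (width seat `ym-line-sfw-p2-w3` g32, cell `ym-idea-1`, free hands): AS TYPED, FC has an indexing gap.  O1 demands the step
`j+1 → j` only under `j + 2 ≤ T` (input height `≤ T − 1`, depth loss `εd (T − (j+2))`), while S3 puts the `κ`-clustered four-point SEED AT
THE TOP `T` and concludes at every `j ∈ [j₁, T]`.  Nothing in O1 consumes the height-`T` seed, so no `(c, a, w)`-datum at `T − 1` exists and
the chain cannot start: `O1 → S3` is not derivable (short of O1 being vacuous).  This file proves the chain for the two natural repairs,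
from ONE abstract real-analysis lemma `finiteChain_core` (part 1/2, `…RunPairOrganFiniteChainCore.lean`: Grönwall + telescoping with a
quadratic feedback, the pattern of the landed 23158 `backwardLiouvilleRigidity_backwardChainLemmaAdm_proof`, p660990):

* R1 (planner-cheap; S3, the composition `yM3TorusSU2_of_stubs` and the BLR edge stay byte-identical): `OneStepContractionRunTop` := O1
  with `j + 1 ≤ T` and `εd (T − (j+1))` — the input may sit at the top, at the one-time depth-0 loss `εd 0` (the card's own KT-W sentence
  «in marginal units the same input costs the one-time O(1) loss εd 0»).  THEOREM `finiteChain_top : OneStepContractionRunTop →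
  BackwardStabilityFin` (S3 verbatim = the skeleton's Prop, definitionally).  Also `oneStepContractionRun_of_top`: R1's organ implies
  the typed O1 (shift `εd`), so R1 STRENGTHENS the organ stub and changes nothing else.
* R2 (B-8(a)-faithful; O1 byte-identical): `BackwardStabilityFinSup` := S3 with a super-top `Tt > T` carrying the tower / class data, the
  seed staying at `T`.  THEOREM `finiteChain_sup : OneStepContractionRun → BackwardStabilityFinSup` (O1 verbatim).  The composition then
  instantiates `Tt := K₀`, `T := J K₀` and needs `J K₀ < K₀` from the seed schedule.

Two thresholds the card's sketch uses silently are folded into `j₁` / `θ` here: `p_T² = β_T·θBal_T² ≥ b₀²` (so `V_T = θω_T/p_T² ≤ (θ/b₀²)·ω_T`;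
S3's `θ` is O1's `θ/b₀²`) and `θBal_j² ≤ 2θ·#Plaq_j` for `j ≥ j₂` (so `p_j²/θ + 2β_j#Plaq_j ≤ 2(1/θ' + 2β_j#Plaq_j)`; the `log 2` sits in
`ε 0`), with `γ₁ ≤ 1`.

HONEST FRAMING: glue only (pure real analysis over heights); the organ O1, the seed S2, the class stubs S1a/S1b are untouched; no organ,
crux, rung or summit is proved; `YM3TorusSU2` and the Yang–Mills mass gap are NOT proved.  R3 is a RECORD rung.
-/

set_option autoImplicit false

open MeasureTheory Filter Topology
open scoped BigOperators
open Literature.MathematicalPhysics.QuantumFieldTheory.Balaban1983to89 T3ContinuumYM3Torus T3NestedUnitLaws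
  T3UnitLawDensityEML T4Continuum BalabanUVClass T3UnitScaleTilt

namespace Summit.QuantumFields.YangMills.Theorems.FluctuationComparisonRegPrIntL.RunPairOrgan

/-! ## The Props (S3 and O1 verbatim; the two repaired variants) -/

/-- S3 · BACKWARD STABILITY ON FINITE RUNS, UNIFORM CONSTANTS — verbatim copy of the skeleton's
`Summit.QuantumFields.YangMills.Cruxes.FluctuationComparisonRegPrIntL.RunPairOrgan.BackwardStabilityFin` (v5/v6; definitionally equal):
constants `θ, C, w₀, ε, δ, j₁` before the pair of finite towers (top `T`, consistent, class data on `[j₀, T]`, floor-class tails `η`),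
`κ`-clustered four-point seed of size `ωT` AT `T`, conclusion = the chained one-bond oscillation bound at every `j ∈ [j₁, T]` under the
two smallness conditions. -/
def BackwardStabilityFin : Prop :=
  ∃ γ₁ : ℝ, 0 < γ₁ ∧ ∀ (F : T3Family) (γ : ℝ), 0 < γ → γ ≤ γ₁ → ∀ (b₀ p₀ κ : ℝ) (j₀ : ℕ) (prm : ℕ → ClassParams) (η : ℕ → ℝ), 0 < b₀ → 0 < p₀ → AdmissibleClassParams F γ b₀ p₀ prm → 0 < κ → (∀ j, 0 ≤ η j) → Summable η → Summable (fun i => ∑' k, η (k + i)) → Tendsto (fun j => (∑' k, η (k + j)) * ((1 + 2 * ((F.L : ℝ) ^ j / γ) * (Fintype.card (Plaq (F.P j) 0) : ℝ)) * (Fintype.card (PBond (F.P j) 0) : ℝ) ^ 2)) atTop (𝓝 0) → ∃ (θ C w₀ : ℝ) (ε δ : ℕ → ℝ) (j₁ : ℕ), 0 < θ ∧ 0 ≤ C ∧ 0 < w₀ ∧ (∀ j, 0 ≤ ε j ∧ 0 ≤ δ j) ∧ Summable ε ∧ Summable δ ∧ Summable (fun i => ∑' k, δ (k + i)) ∧ Tendsto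 (fun j => (∑' k, δ (k + j)) * ((1 + 2 * ((F.L : ℝ) ^ j / γ) * (Fintype.card (Plaq (F.P j) 0) : ℝ)) * (Fintype.card (PBond (F.P j) 0) : ℝ) ^ 2)) atTop (𝓝 0) ∧ j₀ ≤ j₁ ∧ ∀ (T : ℕ) (ωT : ℝ), 0 ≤ ωT → ∀ (μ μ' : ((j : ℕ) → MeasureTheory.Measure (GaugeField (F.P j) 0 ↥(Matrix.specialUnitaryGroup (Fin 2) ℂ)))) (ρ ρ' : ((j : ℕ) → GaugeField (F.P j) 0 ↥(Matrix.specialUnitaryGroup (Fin 2) ℂ) → ℝ)), (∀ j : ℕ, j ≤ T → IsProbabilityMeasure (μ j) ∧ IsProbabilityMeasure (μ' j)) → (∀ j : ℕ, j < T → μ j = Measure.map (descend F ℰp j) (μ (j + 1)) ∧ μ' j = Measure.map (descend F ℰp j) (μ' (j + 1))) → (∀ j : ℕ, j₀ ≤ j → j ≤ T → ((∀ U, PlaqSmall (θBal F.L γ b₀ p₀ j) U → 0 < ρ j U ∧ 0 < ρ' j U) ∧ μ j = (fieldMeasure _ _ _).withDensity (fun U => ENNReal.ofReal (ρ j U)) ∧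 μ' j = (fieldMeasure _ _ _).withDensity (fun U => ENNReal.ofReal (ρ' j U)) ∧ MemAtHeight F ℰp j (prm j) (ρ j) ∧ MemAtHeight F ℰp j (prm j) (ρ' j) ∧ μ j {U | ¬ PlaqSmall (θBal F.L γ b₀ p₀ j) U} ≤ ENNReal.ofReal (η j) ∧ μ' j {U | ¬ PlaqSmall (θBal F.L γ b₀ p₀ j) U} ≤ ENNReal.ofReal (η j) ∧ (ContinuousOn (ρ j) {U | PlaqSmall (θBal F.L γ b₀ p₀ j) U} ∧ ContinuousOn (ρ' j) {U | PlaqSmall (θBal F.L γ b₀ p₀ j) U}))) → (∀ (b b' : PBond (F.P T) 0) U V W Z, PlaqSmall (θBal F.L γ b₀ p₀ T) U → PlaqSmall (θBal F.L γ b₀ p₀ T) V → PlaqSmall (θBal F.L γ b₀ p₀ T) W → PlaqSmall (θBal F.L γ b₀ p₀ T) Z → (∀ e, e ≠ b → U e = V e) → (∀ e, e ≠ b' → U e = W e) → (∀ e, e ≠ b' → V e = Z e) → (∀ e, e ≠ b → W e = Z e) → |(Real.log (ρ T U) - Real.log (ρ' T U)) - (Real.log (ρ T V) - Real.log (ρ'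 T V)) - ((Real.log (ρ T W) - Real.log (ρ' T W)) - (Real.log (ρ T Z) - Real.log (ρ' T Z)))| ≤ ωT * Real.exp (-(κ * (b.src.tdist b'.src : ℝ)))) → ∀ (j : ℕ), j₁ ≤ j → j ≤ T → Real.exp (∑' k, ε k + 1) * (θ * ωT + (∑' k, δ (k + j))) ≤ w₀ → C * (Real.exp (∑' k, ε k + 1) * ((T : ℝ) * (θ * ωT) + (∑' i, ∑' k, δ (k + (i + j))))) ≤ 1 → ∀ (b : PBond (F.P j) 0) U V, PlaqSmall (θBal F.L γ b₀ p₀ j) U → PlaqSmall (θBal F.L γ b₀ p₀ j) V → (∀ e, e ≠ b → U e = V e) → |(Real.log (ρ j U) - Real.log (ρ' j U)) - (Real.log (ρ j V) - Real.log (ρ' j V))| ≤ Real.exp (∑' k, ε k + 1) * (θ * ωT + (∑' k, δ (k + j))) * (1 / θ + 2 * ((F.L : ℝ) ^ j / γ) * (Fintype.card (Plaq (F.P j) 0) : ℝ))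

/-- O1 · LOCAL ONE-STEP ORGAN ON FINITE TOWERS — verbatim copy of the skeleton's
`Summit.QuantumFields.YangMills.Cruxes.FluctuationComparisonRegPrIntL.RunPairOrgan.OneStepContractionRun` (v5/v6; definitionally equal):
the step `j+1 → j` in the `(c, a, w)` currency with marginal-unit weight `θ/(β_j θBal_j²)`, demanded only for `j + 2 ≤ T` (TWO-HEIGHT
input), factor `1 + ε j + εd (T − (j+2)) + C·V`, floor `δ j`. -/
def OneStepContractionRun : Prop :=
  ∃ γ₁ : ℝ, 0 < γ₁ ∧ ∀ (F : T3Family) (γ : ℝ), 0 < γ → γ ≤ γ₁ → ∀ (b₀ p₀ κ : ℝ) (j₀ : ℕ) (prm : ℕ → ClassParams) (η : ℕ → ℝ), 0 < b₀ → 0 < p₀ → AdmissibleClassParams F γ b₀ p₀ prm → 0 < κ → (∀ j, 0 ≤ η j) → Summable η → Summable (fun i => ∑' k, η (k + i)) → Tendsto (fun j => (∑' k, η (k + j)) * ((1 + 2 * ((F.L : ℝ) ^ j / γ) * (Fintype.card (Plaq (F.P j) 0) : ℝ)) * (Fintype.card (PBond (F.P j) 0) : ℝ) ^ 2)) atTop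 (𝓝 0) → ∃ (θ C w₀ : ℝ) (ε εd δ : ℕ → ℝ) (j₁ : ℕ), 0 < θ ∧ 0 ≤ C ∧ 0 < w₀ ∧ (∀ j, 0 ≤ ε j ∧ 0 ≤ εd j ∧ 0 ≤ δ j) ∧ Summable ε ∧ Summable εd ∧ Summable δ ∧ Summable (fun i => ∑' k, δ (k + i)) ∧ Tendsto (fun j => (∑' k, δ (k + j)) * ((1 + 2 * ((F.L : ℝ) ^ j / γ) * (Fintype.card (Plaq (F.P j) 0) : ℝ)) * (Fintype.card (PBond (F.P j) 0) : ℝ) ^ 2)) atTop (𝓝 0) ∧ j₀ ≤ j₁ ∧ ∀ (T : ℕ), ∀ (μ μ' : ((j : ℕ) → MeasureTheory.Measure (GaugeField (F.P j) 0 ↥(Matrix.specialUnitaryGroup (Fin 2) ℂ)))) (ρ ρ' : ((j : ℕ) → GaugeField (F.P j) 0 ↥(Matrix.specialUnitaryGroup (Fin 2) ℂ) → ℝ)), (∀ j : ℕ, j ≤ T → IsProbabilityMeasure (μ j) ∧ IsProbabilityMeasure (μ' j)) → (∀ j : ℕ, j < T → μ j = Measure.map (descend F ℰp j) (μ (j +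 1)) ∧ μ' j = Measure.map (descend F ℰp j) (μ' (j + 1))) → (∀ j : ℕ, j₀ ≤ j → j ≤ T → ((∀ U, PlaqSmall (θBal F.L γ b₀ p₀ j) U → 0 < ρ j U ∧ 0 < ρ' j U) ∧ μ j = (fieldMeasure _ _ _).withDensity (fun U => ENNReal.ofReal (ρ j U)) ∧ μ' j = (fieldMeasure _ _ _).withDensity (fun U => ENNReal.ofReal (ρ' j U)) ∧ MemAtHeight F ℰp j (prm j) (ρ j) ∧ MemAtHeight F ℰp j (prm j) (ρ' j) ∧ μ j {U | ¬ PlaqSmall (θBal F.L γ b₀ p₀ j) U} ≤ ENNReal.ofReal (η j) ∧ μ' j {U | ¬ PlaqSmall (θBal F.L γ b₀ p₀ j) U} ≤ ENNReal.ofReal (η j) ∧ (ContinuousOn (ρ j) {U | PlaqSmall (θBal F.L γ b₀ p₀ j) U} ∧ ContinuousOn (ρ' j) {U | PlaqSmall (θBal F.L γ b₀ p₀ j) U}))) → ∀ (j : ℕ), j₁ ≤ j → j + 2 ≤ T → ∀ (c : Plaq (F.P (j + 1)) 0 → ℝ) (a w : ℝ), 0 ≤ a → 0 ≤ w → a + θ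 / (((F.L : ℝ) ^ (j + 1) / γ) * θBal F.L γ b₀ p₀ (j + 1) ^ 2) * w ≤ w₀ → ((∀ p, |c p| ≤ a) ∧ (∀ (b b' : PBond (F.P (j + 1)) 0) U V W Z, PlaqSmall (θBal F.L γ b₀ p₀ (j + 1)) U → PlaqSmall (θBal F.L γ b₀ p₀ (j + 1)) V → PlaqSmall (θBal F.L γ b₀ p₀ (j + 1)) W → PlaqSmall (θBal F.L γ b₀ p₀ (j + 1)) Z → (∀ e, e ≠ b → U e = V e) → (∀ e, e ≠ b' → U e = W e) → (∀ e, e ≠ b' → V e = Z e) → (∀ e, e ≠ b → W e = Z e) → |(Real.log (ρ (j + 1) U) - Real.log (ρ' (j + 1) U) - ((F.L : ℝ) ^ (j + 1) / γ) * ∑ p, c p * (1 - reTr (GaugeField.plaqHol U p))) - (Real.log (ρ (j + 1) V) - Real.log (ρ' (j + 1) V) - ((F.L : ℝ) ^ (j + 1) / γ) * ∑ p, c p * (1 - reTr (GaugeField.plaqHol V p))) - ((Real.log (ρ (j + 1) W) - Real.log (ρ' (j + 1) W) - ((F.L : ℝ) ^ (j + 1) / γ) * ∑ p, c p * (1 -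 reTr (GaugeField.plaqHol W p))) - (Real.log (ρ (j + 1) Z) - Real.log (ρ' (j + 1) Z) - ((F.L : ℝ) ^ (j + 1) / γ) * ∑ p, c p * (1 - reTr (GaugeField.plaqHol Z p))))| ≤ w * Real.exp (-(κ * (b.src.tdist b'.src : ℝ))))) → ∃ (c' : Plaq (F.P j) 0 → ℝ) (a' w' : ℝ), 0 ≤ a' ∧ 0 ≤ w' ∧ a' + θ / (((F.L : ℝ) ^ j / γ) * θBal F.L γ b₀ p₀ j ^ 2) * w' ≤ (1 + ε j + εd (T - (j + 2)) + C * (a + θ / (((F.L : ℝ) ^ (j + 1) / γ) * θBal F.L γ b₀ p₀ (j + 1) ^ 2) * w)) * (a + θ / (((F.L : ℝ) ^ (j + 1) / γ) * θBal F.L γ b₀ p₀ (j + 1) ^ 2) * w) + δ j ∧ ((∀ p, |c' p| ≤ a') ∧ (∀ (b b' : PBond (F.P j) 0) U V W Z, PlaqSmall (θBal F.L γ b₀ p₀ j) U → PlaqSmall (θBal F.L γ b₀ p₀ j) V → PlaqSmall (θBal F.L γ b₀ p₀ j) W → PlaqSmall (θBal F.L γ b₀ p₀ j) Z → (∀ e,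 e ≠ b → U e = V e) → (∀ e, e ≠ b' → U e = W e) → (∀ e, e ≠ b' → V e = Z e) → (∀ e, e ≠ b → W e = Z e) → |(Real.log (ρ j U) - Real.log (ρ' j U) - ((F.L : ℝ) ^ j / γ) * ∑ p, c' p * (1 - reTr (GaugeField.plaqHol U p))) - (Real.log (ρ j V) - Real.log (ρ' j V) - ((F.L : ℝ) ^ j / γ) * ∑ p, c' p * (1 - reTr (GaugeField.plaqHol V p))) - ((Real.log (ρ j W) - Real.log (ρ' j W) - ((F.L : ℝ) ^ j / γ) * ∑ p, c' p * (1 - reTr (GaugeField.plaqHol W p))) - (Real.log (ρ j Z) - Real.log (ρ' j Z) - ((F.L : ℝ) ^ j / γ) * ∑ p, c' p * (1 - reTr (GaugeField.plaqHol Z p))))| ≤ w' * Real.exp (-(κ * (b.src.tdist b'.src : ℝ)))))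

/-- R1 · `OneStepContractionRunTop` — O1 with the input allowed AT THE TOP: byte-identical to `OneStepContractionRun` except
`j + 2 ≤ T` ↦ `j + 1 ≤ T` and `εd (T - (j + 2))` ↦ `εd (T - (j + 1))` (the loss is indexed by the DEPTH of the input below the top,
depth `0` allowed at the one-time loss `εd 0`).  This is the proposed re-typing of the skeleton's O1 under which FC is provable with
S3 unchanged (`finiteChain_top`); it implies the typed O1 (`oneStepContractionRun_of_top`). -/
def OneStepContractionRunTop : Prop :=
  ∃ γ₁ : ℝ, 0 < γ₁ ∧ ∀ (F : T3Family) (γ : ℝ), 0 < γ → γ ≤ γ₁ → ∀ (b₀ p₀ κ : ℝ) (j₀ : ℕ) (prm : ℕ → ClassParams) (η : ℕ → ℝ), 0 < b₀ → 0 < p₀ → AdmissibleClassParams F γ b₀ p₀ prm → 0 < κ → (∀ j, 0 ≤ η j) → Summable η → Summable (fun i => ∑' k, η (k + i)) → Tendsto (fun j => (∑' k, η (k + j)) * ((1 + 2 * ((F.L : ℝ) ^ j / γ) * (Fintype.card (Plaq (F.P j) 0) : ℝ)) * (Fintype.card (PBond (F.P j) 0) : ℝ) ^ 2)) atTop (𝓝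 0) → ∃ (θ C w₀ : ℝ) (ε εd δ : ℕ → ℝ) (j₁ : ℕ), 0 < θ ∧ 0 ≤ C ∧ 0 < w₀ ∧ (∀ j, 0 ≤ ε j ∧ 0 ≤ εd j ∧ 0 ≤ δ j) ∧ Summable ε ∧ Summable εd ∧ Summable δ ∧ Summable (fun i => ∑' k, δ (k + i)) ∧ Tendsto (fun j => (∑' k, δ (k + j)) * ((1 + 2 * ((F.L : ℝ) ^ j / γ) * (Fintype.card (Plaq (F.P j) 0) : ℝ)) * (Fintype.card (PBond (F.P j) 0) : ℝ) ^ 2)) atTop (𝓝 0) ∧ j₀ ≤ j₁ ∧ ∀ (T : ℕ), ∀ (μ μ' : ((j : ℕ) → MeasureTheory.Measure (GaugeField (F.P j) 0 ↥(Matrix.specialUnitaryGroup (Fin 2) ℂ)))) (ρ ρ' : ((j : ℕ) → GaugeField (F.P j) 0 ↥(Matrix.specialUnitaryGroup (Fin 2) ℂ) → ℝ)), (∀ j : ℕ, j ≤ T → IsProbabilityMeasure (μ j) ∧ IsProbabilityMeasure (μ' j)) → (∀ j : ℕ, j < T → μ j = Measure.map (descend F ℰp j) (μ (j + 1)) ∧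 μ' j = Measure.map (descend F ℰp j) (μ' (j + 1))) → (∀ j : ℕ, j₀ ≤ j → j ≤ T → ((∀ U, PlaqSmall (θBal F.L γ b₀ p₀ j) U → 0 < ρ j U ∧ 0 < ρ' j U) ∧ μ j = (fieldMeasure _ _ _).withDensity (fun U => ENNReal.ofReal (ρ j U)) ∧ μ' j = (fieldMeasure _ _ _).withDensity (fun U => ENNReal.ofReal (ρ' j U)) ∧ MemAtHeight F ℰp j (prm j) (ρ j) ∧ MemAtHeight F ℰp j (prm j) (ρ' j) ∧ μ j {U | ¬ PlaqSmall (θBal F.L γ b₀ p₀ j) U} ≤ ENNReal.ofReal (η j) ∧ μ' j {U | ¬ PlaqSmall (θBal F.L γ b₀ p₀ j) U} ≤ ENNReal.ofReal (η j) ∧ (ContinuousOn (ρ j) {U | PlaqSmall (θBal F.L γ b₀ p₀ j) U} ∧ ContinuousOn (ρ' j) {U | PlaqSmall (θBal F.L γ b₀ p₀ j) U}))) → ∀ (j : ℕ), j₁ ≤ j → j + 1 ≤ T → ∀ (c : Plaq (F.P (j + 1)) 0 → ℝ) (a w : ℝ), 0 ≤ a → 0 ≤ w → a + θ / (((F.L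 : ℝ) ^ (j + 1) / γ) * θBal F.L γ b₀ p₀ (j + 1) ^ 2) * w ≤ w₀ → ((∀ p, |c p| ≤ a) ∧ (∀ (b b' : PBond (F.P (j + 1)) 0) U V W Z, PlaqSmall (θBal F.L γ b₀ p₀ (j + 1)) U → PlaqSmall (θBal F.L γ b₀ p₀ (j + 1)) V → PlaqSmall (θBal F.L γ b₀ p₀ (j + 1)) W → PlaqSmall (θBal F.L γ b₀ p₀ (j + 1)) Z → (∀ e, e ≠ b → U e = V e) → (∀ e, e ≠ b' → U e = W e) → (∀ e, e ≠ b' → V e = Z e) → (∀ e, e ≠ b → W e = Z e) → |(Real.log (ρ (j + 1) U) - Real.log (ρ' (j + 1) U) - ((F.L : ℝ) ^ (j + 1) / γ) * ∑ p, c p * (1 - reTr (GaugeField.plaqHol U p))) - (Real.log (ρ (j + 1) V) - Real.log (ρ' (j + 1) V) - ((F.L : ℝ) ^ (j + 1) / γ) * ∑ p, c p * (1 - reTr (GaugeField.plaqHol V p))) - ((Real.log (ρ (j + 1) W) - Real.log (ρ' (j + 1) W) - ((F.L : ℝ) ^ (j + 1) / γ) * ∑ p, c p * (1 - reTr (GaugeField.plaqHol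 W p))) - (Real.log (ρ (j + 1) Z) - Real.log (ρ' (j + 1) Z) - ((F.L : ℝ) ^ (j + 1) / γ) * ∑ p, c p * (1 - reTr (GaugeField.plaqHol Z p))))| ≤ w * Real.exp (-(κ * (b.src.tdist b'.src : ℝ))))) → ∃ (c' : Plaq (F.P j) 0 → ℝ) (a' w' : ℝ), 0 ≤ a' ∧ 0 ≤ w' ∧ a' + θ / (((F.L : ℝ) ^ j / γ) * θBal F.L γ b₀ p₀ j ^ 2) * w' ≤ (1 + ε j + εd (T - (j + 1)) + C * (a + θ / (((F.L : ℝ) ^ (j + 1) / γ) * θBal F.L γ b₀ p₀ (j + 1) ^ 2) * w)) * (a + θ / (((F.L : ℝ) ^ (j + 1) / γ) * θBal F.L γ b₀ p₀ (j + 1) ^ 2) * w) + δ j ∧ ((∀ p, |c' p| ≤ a') ∧ (∀ (b b' : PBond (F.P j) 0) U V W Z, PlaqSmall (θBal F.L γ b₀ p₀ j) U → PlaqSmall (θBal F.L γ b₀ p₀ j) V → PlaqSmall (θBal F.L γ b₀ p₀ j) W → PlaqSmall (θBal F.L γ b₀ p₀ j) Z → (∀ e, e ≠ b → U e = V e) →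 (∀ e, e ≠ b' → U e = W e) → (∀ e, e ≠ b' → V e = Z e) → (∀ e, e ≠ b → W e = Z e) → |(Real.log (ρ j U) - Real.log (ρ' j U) - ((F.L : ℝ) ^ j / γ) * ∑ p, c' p * (1 - reTr (GaugeField.plaqHol U p))) - (Real.log (ρ j V) - Real.log (ρ' j V) - ((F.L : ℝ) ^ j / γ) * ∑ p, c' p * (1 - reTr (GaugeField.plaqHol V p))) - ((Real.log (ρ j W) - Real.log (ρ' j W) - ((F.L : ℝ) ^ j / γ) * ∑ p, c' p * (1 - reTr (GaugeField.plaqHol W p))) - (Real.log (ρ j Z) - Real.log (ρ' j Z) - ((F.L : ℝ) ^ j / γ) * ∑ p, c' p * (1 - reTr (GaugeField.plaqHol Z p))))| ≤ w' * Real.exp (-(κ * (b.src.tdist b'.src : ℝ)))))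

/-- R2 · `BackwardStabilityFinSup` — S3 with a SUPER-TOP: byte-identical to `BackwardStabilityFin` except that the towers are
probability / consistent / in the class up to a height `Tt` with `T < Tt`, the four-point seed staying at `T` (so the typed O1, which
needs admissible data one height ABOVE its input, can consume the seed).  FC is provable in this form with O1 unchanged
(`finiteChain_sup`); the composition instantiates `Tt := K₀`, `T := J K₀ < K₀`. -/
def BackwardStabilityFinSup : Prop :=
  ∃ γ₁ : ℝ, 0 < γ₁ ∧ ∀ (F : T3Family) (γ : ℝ), 0 < γ → γ ≤ γ₁ → ∀ (b₀ p₀ κ : ℝ) (j₀ : ℕ) (prm : ℕ → ClassParams) (η : ℕ → ℝ), 0 < b₀ → 0 < p₀ → AdmissibleClassParams F γ b₀ p₀ prm → 0 < κ → (∀ j, 0 ≤ η j) → Summable η → Summable (fun i => ∑' k, η (k + i)) → Tendsto (fun j => (∑' k, η (k + j)) * ((1 + 2 * ((F.L : ℝ) ^ j / γ) * (Fintype.card (Plaq (F.P j) 0) : ℝ)) * (Fintype.card (PBond (F.P j) 0) : ℝ) ^ 2)) atTop (𝓝 0) → ∃ (θ C w₀ : ℝ) (ε δ : ℕ → ℝ)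 (j₁ : ℕ), 0 < θ ∧ 0 ≤ C ∧ 0 < w₀ ∧ (∀ j, 0 ≤ ε j ∧ 0 ≤ δ j) ∧ Summable ε ∧ Summable δ ∧ Summable (fun i => ∑' k, δ (k + i)) ∧ Tendsto (fun j => (∑' k, δ (k + j)) * ((1 + 2 * ((F.L : ℝ) ^ j / γ) * (Fintype.card (Plaq (F.P j) 0) : ℝ)) * (Fintype.card (PBond (F.P j) 0) : ℝ) ^ 2)) atTop (𝓝 0) ∧ j₀ ≤ j₁ ∧ ∀ (T Tt : ℕ) (ωT : ℝ), T < Tt → 0 ≤ ωT → ∀ (μ μ' : ((j : ℕ) → MeasureTheory.Measure (GaugeField (F.P j) 0 ↥(Matrix.specialUnitaryGroup (Fin 2) ℂ)))) (ρ ρ' : ((j : ℕ) → GaugeField (F.P j) 0 ↥(Matrix.specialUnitaryGroup (Fin 2) ℂ) → ℝ)), (∀ j : ℕ, j ≤ Tt → IsProbabilityMeasure (μ j) ∧ IsProbabilityMeasure (μ' j)) → (∀ j : ℕ, j < Tt → μ j = Measure.map (descend F ℰp j) (μ (j + 1)) ∧ μ' j = Measure.map (descend F ℰp j) (μ' (j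 + 1))) → (∀ j : ℕ, j₀ ≤ j → j ≤ Tt → ((∀ U, PlaqSmall (θBal F.L γ b₀ p₀ j) U → 0 < ρ j U ∧ 0 < ρ' j U) ∧ μ j = (fieldMeasure _ _ _).withDensity (fun U => ENNReal.ofReal (ρ j U)) ∧ μ' j = (fieldMeasure _ _ _).withDensity (fun U => ENNReal.ofReal (ρ' j U)) ∧ MemAtHeight F ℰp j (prm j) (ρ j) ∧ MemAtHeight F ℰp j (prm j) (ρ' j) ∧ μ j {U | ¬ PlaqSmall (θBal F.L γ b₀ p₀ j) U} ≤ ENNReal.ofReal (η j) ∧ μ' j {U | ¬ PlaqSmall (θBal F.L γ b₀ p₀ j) U} ≤ ENNReal.ofReal (η j) ∧ (ContinuousOn (ρ j) {U | PlaqSmall (θBal F.L γ b₀ p₀ j) U} ∧ ContinuousOn (ρ' j) {U | PlaqSmall (θBal F.L γ b₀ p₀ j) U}))) → (∀ (b b' : PBond (F.P T) 0) U V W Z, PlaqSmall (θBal F.L γ b₀ p₀ T) U → PlaqSmall (θBal F.L γ b₀ p₀ T) V → PlaqSmall (θBal F.L γ b₀ p₀ T) W → PlaqSmall (θBal F.L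 γ b₀ p₀ T) Z → (∀ e, e ≠ b → U e = V e) → (∀ e, e ≠ b' → U e = W e) → (∀ e, e ≠ b' → V e = Z e) → (∀ e, e ≠ b → W e = Z e) → |(Real.log (ρ T U) - Real.log (ρ' T U)) - (Real.log (ρ T V) - Real.log (ρ' T V)) - ((Real.log (ρ T W) - Real.log (ρ' T W)) - (Real.log (ρ T Z) - Real.log (ρ' T Z)))| ≤ ωT * Real.exp (-(κ * (b.src.tdist b'.src : ℝ)))) → ∀ (j : ℕ), j₁ ≤ j → j ≤ T → Real.exp (∑' k, ε k + 1) * (θ * ωT + (∑' k, δ (k + j))) ≤ w₀ → C * (Real.exp (∑' k, ε k + 1) * ((T : ℝ) * (θ * ωT) + (∑' i, ∑' k, δ (k + (i + j))))) ≤ 1 → ∀ (b : PBond (F.P j) 0) U V, PlaqSmall (θBal F.L γ b₀ p₀ j) U → PlaqSmall (θBal F.L γ b₀ p₀ j) V → (∀ e, e ≠ b → U e = V e) → |(Real.log (ρ j U) - Real.log (ρ' j U)) - (Real.log (ρ j V) - Real.log (ρ' j V))| ≤ Real.exp (∑' k, ε k + 1) * (θ * ωT + (∑' k, δ (k + j)))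 * (1 / θ + 2 * ((F.L : ℝ) ^ j / γ) * (Fintype.card (Plaq (F.P j) 0) : ℝ))

/-! ## R1: the chain with the input allowed at the top (S3 verbatim) -/

/-- **FC, repair R1.** `OneStepContractionRunTop → BackwardStabilityFin`: iterate the one-step organ from the top `T` (datum `c = 0`,
`a = 0`, `w = ω_T`, potential `θω_T/p_T² ≤ (θ/b₀²)·ω_T`) down to `j` by `finiteChain_core` (losses `ε i + εd (T−(i+1))`, each depth
once, total `≤ Σ'ε + Σ'εd`), then read the one-bond oscillation off the datum at `j` by `osc_of_datum` (threshold height `j₂` folded into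
`j₁`, the factor `2` into `ε 0` as `log 2`; S3's `θ` is O1's `θ/b₀²`, `γ₁ ≤ 1`). [folklore] -/
theorem finiteChain_top : OneStepContractionRunTop → BackwardStabilityFin := by
  classical
  rintro ⟨γ₁, hγ₁, H⟩
  refine ⟨min γ₁ 1, lt_min hγ₁ one_pos, ?_⟩
  intro F γ hγ hle b₀ p₀ κ j₀ prm η hb₀ hp₀ hadm hκ hη0 hηs hηs2 hηt
  have hγ₁' : γ ≤ γ₁ := hle.trans (min_le_left _ _)
  have hγ1 : γ ≤ 1 := hle.trans (min_le_right _ _)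
  obtain ⟨θ, C, w₀, ε, εd, δ, j₁, hθ, hC, hw₀, hεδ, hεs, hεds, hδs, hDs, hD0, hj₀₁, hstep⟩ :=
    H F γ hγ hγ₁' b₀ p₀ κ j₀ prm η hb₀ hp₀ hadm hκ hη0 hηs hηs2 hηt
  obtain ⟨j₂, hj₂⟩ := exists_threshold_height F hγ hγ1 hb₀ hθ p₀
  have hite : HasSum (fun k : ℕ => if k = 0 then Real.log 2 else 0) (Real.log 2) := hasSum_ite_eq 0 _
  have hlog2 : 0 < Real.log 2 := Real.log_pos one_lt_two
  refine ⟨θ / b₀ ^ 2, C, w₀, fun k => ε k + εd k + (if k = 0 then Real.log 2 else 0), δ, max j₁ j₂,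
    by positivity, hC, hw₀, fun k => ⟨?_, (hεδ k).2.2⟩, (hεs.add hεds).add hite.summable, hδs, hDs, hD0,
    hj₀₁.trans (le_max_left _ _), ?_⟩
  · have h1 := (hεδ k).1
    have h2 := (hεδ k).2.1
    have h3 : (0 : ℝ) ≤ (if k = 0 then Real.log 2 else 0) := by split_ifs <;> linarith
    show 0 ≤ ε k + εd k + (if k = 0 then Real.log 2 else 0)
    linarith
  intro T ωT hωT μ μ' ρ ρ' hprob hcons hcl hseed j hj hjT hsmall hquad b U V hU hV hUV
  have hj₁ : j₁ ≤ j := (le_max_left _ _).trans hj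
  have hj₂' : j₂ ≤ j := (le_max_right _ _).trans hj
  -- the total loss `E` and the factor `2 = e^{log 2}`
  set E : ℝ := ∑' k, ε k + ∑' k, εd k with hEdef
  have hsumε' : ∑' k, (ε k + εd k + (if k = 0 then Real.log 2 else 0)) = E + Real.log 2 := by
    rw [(hεs.add hεds).tsum_add hite.summable, hεs.tsum_add hεds, hite.tsum_eq]
  have hexpE : Real.exp ((E + Real.log 2) + 1) = Real.exp (E + 1) * 2 := by
    rw [show (E + Real.log 2) + 1 = (E + 1) + Real.log 2 by ring, Real.exp_add, Real.exp_log two_pos]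
  have hexp_le : Real.exp (E + 1) ≤ Real.exp ((E + Real.log 2) + 1) := Real.exp_le_exp.mpr (by linarith)
  have hG : 0 < Real.exp (E + 1) := Real.exp_pos _
  simp only [hsumε'] at hsmall hquad ⊢
  -- marginal weights
  have hm0 : ∀ i, 0 ≤ θ / ((F.L : ℝ) ^ i / γ * θBal F.L γ b₀ p₀ i ^ 2) := fun i => by positivity
  have hmj : 0 < θ / ((F.L : ℝ) ^ j / γ * θBal F.L γ b₀ p₀ j ^ 2) := by
    have hθB := T3MinimiserStabilityReduction.θBal_pos (L := F.L) F.hL.2.le hγ hγ1 hb₀ p₀ j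
    have hL0 : (0 : ℝ) < F.L := by exact_mod_cast (zero_lt_one.trans F.hL.2)
    exact div_pos hθ (mul_pos (div_pos (pow_pos hL0 j) hγ) (pow_pos hθB 2))
  have hmT : θ / ((F.L : ℝ) ^ T / γ * θBal F.L γ b₀ p₀ T ^ 2) ≤ θ / b₀ ^ 2 :=
    marginalWeight_le F hγ hγ1 hb₀ hp₀ hθ.le T
  set B : ℝ := θ / ((F.L : ℝ) ^ T / γ * θBal F.L γ b₀ p₀ T ^ 2) * ωT with hBdef
  have hB0 : 0 ≤ B := mul_nonneg (hm0 T) hωT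
  have hBle : B ≤ θ / b₀ ^ 2 * ωT := mul_le_mul_of_nonneg_right hmT hωT
  have hθ' : 0 < θ / b₀ ^ 2 := by positivity
  have hDt0 : 0 ≤ ∑' k, δ (k + j) := tsum_nonneg fun k => (hεδ _).2.2
  have hDD0 : 0 ≤ ∑' i, ∑' k, δ (k + (i + j)) := tsum_nonneg fun i => tsum_nonneg fun k => (hεδ _).2.2
  -- the reflected loss sum
  have hEsum : ∑ k ∈ Finset.Ico j T, (ε k + εd (T - (k + 1))) ≤ E := by
    rw [Finset.sum_add_distrib]
    exact add_le_add (hεs.sum_le_tsum _ fun k _ => (hεδ k).1)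
      (sum_Ico_reflect_le_tsum (fun n => (hεδ n).2.1) hεds j T)
  -- the two smallness conditions in the chain's currency
  have hsmall' : Real.exp (E + 1) * (B + ∑' k, δ (k + j)) ≤ w₀ :=
    le_trans (mul_le_mul hexp_le (by linarith) (by linarith) (Real.exp_pos _).le) hsmall
  have hquad' : C * (Real.exp (E + 1) * (((T - j : ℕ) : ℝ) * B + ∑' i, ∑' k, δ (k + (i + j)))) ≤ 1 := by
    have hTj : ((T - j : ℕ) : ℝ) ≤ (T : ℝ) := by exact_mod_cast Nat.sub_le T j
    have h1 : ((T - j : ℕ) : ℝ) * B ≤ (T : ℝ) * (θ / b₀ ^ 2 * ωT) :=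
      mul_le_mul hTj hBle hB0 (Nat.cast_nonneg _)
    have h2 : Real.exp (E + 1) * (((T - j : ℕ) : ℝ) * B + ∑' i, ∑' k, δ (k + (i + j))) ≤
        Real.exp ((E + Real.log 2) + 1) * ((T : ℝ) * (θ / b₀ ^ 2 * ωT) + ∑' i, ∑' k, δ (k + (i + j))) :=
      mul_le_mul hexp_le (by linarith) (by positivity) (Real.exp_pos _).le
    exact le_trans (mul_le_mul_of_nonneg_left h2 hC) hquad
  -- the chain
  obtain ⟨a, w, ha, hw, hVle, c, hcB, h4⟩ := finiteChain_core
    (fun i a w => ∃ c : Plaq (F.P i) 0 → ℝ, (∀ p, |c p| ≤ a) ∧ (∀ (b b' : PBond (F.P i) 0) U V W Z, PlaqSmall (θBal F.L γ b₀ p₀ i) U → PlaqSmall (θBal F.L γ b₀ p₀ i) V → PlaqSmall (θBal F.L γ b₀ p₀ i) W → PlaqSmall (θBal F.L γ b₀ p₀ i) Z → (∀ e, e ≠ b → U e = V e) → (∀ e, e ≠ b' → U e = W e) → (∀ e, e ≠ b' → V e = Z e) → (∀ e, e ≠ b → W e = Z e) → |(Real.log (ρ i U) - Real.log (ρ' i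 U) - ((F.L : ℝ) ^ i / γ) * ∑ p, c p * (1 - reTr (GaugeField.plaqHol U p))) - (Real.log (ρ i V) - Real.log (ρ' i V) - ((F.L : ℝ) ^ i / γ) * ∑ p, c p * (1 - reTr (GaugeField.plaqHol V p))) - ((Real.log (ρ i W) - Real.log (ρ' i W) - ((F.L : ℝ) ^ i / γ) * ∑ p, c p * (1 - reTr (GaugeField.plaqHol W p))) - (Real.log (ρ i Z) - Real.log (ρ' i Z) - ((F.L : ℝ) ^ i / γ) * ∑ p, c p * (1 - reTr (GaugeField.plaqHol Z p))))| ≤ w * Real.exp (-(κ * (b.src.tdist b'.src : ℝ)))))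
    (fun i => θ / ((F.L : ℝ) ^ i / γ * θBal F.L γ b₀ p₀ i ^ 2))
    (fun i => ε i + εd (T - (i + 1))) δ C w₀ B E j T
    hm0 (fun i => add_nonneg (hεδ i).1 (hεδ _).2.1) (fun i => (hεδ i).2.2) hC hB0 hδs hDs hEsum hjT
    ⟨0, ωT, le_rfl, hωT, by simp [hBdef], fun _ => 0, fun p => by simp, by
      intro b₁ b₂ U₁ V₁ W₁ Z₁ hU₁ hV₁ hW₁ hZ₁ h₁ h₂ h₃ h₄
      simp only [zero_mul, Finset.sum_const_zero, mul_zero, sub_zero]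
      exact hseed b₁ b₂ U₁ V₁ W₁ Z₁ hU₁ hV₁ hW₁ hZ₁ h₁ h₂ h₃ h₄⟩
    (by
      intro i hji hiT a w ha hw hside hD
      obtain ⟨c, hcB, h4⟩ := hD
      obtain ⟨c', a', w', ha', hw', hV', hcB', h4'⟩ :=
        hstep T μ μ' ρ ρ' hprob hcons hcl i (hj₁.trans hji) hiT c a w ha hw hside ⟨hcB, h4⟩
      refine ⟨a', w', ha', hw', ?_, c', hcB', h4'⟩
      linarith [hV'])
    hsmall' hquad'
  -- termination at height `j`
  have hW0 : 0 ≤ Real.exp (E + 1) * (B + ∑' k, δ (k + j)) := mul_nonneg hG.le (add_nonneg hB0 hDt0)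
  have hosc := osc_of_datum F (ρ j) (ρ' j) c ha hw hγ hκ.le hθ' hW0 hmj hVle (hj₂ j hj₂') hcB h4 b U V hU hV hUV
  have hX0 : 0 ≤ 1 / (θ / b₀ ^ 2) + 2 * ((F.L : ℝ) ^ j / γ) * (Fintype.card (Plaq (F.P j) 0) : ℝ) := by positivity
  refine hosc.trans ?_
  rw [hexpE]
  have h2W : 2 * (Real.exp (E + 1) * (B + ∑' k, δ (k + j))) ≤ Real.exp (E + 1) * 2 * (θ / b₀ ^ 2 * ωT + ∑' k, δ (k + j)) := by
    have := mul_le_mul_of_nonneg_left (add_le_add_right hBle (∑' k, δ (k + j))) hG.le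
    linarith
  exact mul_le_mul_of_nonneg_right h2W hX0

/-- R1's organ is STRONGER than the typed one: `OneStepContractionRunTop → OneStepContractionRun` (shift the depth loss,
`εd' n := εd (n+1)`; for `j + 2 ≤ T` one has `T − (j+2) + 1 = T − (j+1)`).  So re-typing O1 as `OneStepContractionRunTop` changes
nothing downstream of O1 in the skeleton. [folklore] -/
theorem oneStepContractionRun_of_top : OneStepContractionRunTop → OneStepContractionRun := by
  rintro ⟨γ₁, hγ₁, H⟩
  refine ⟨γ₁, hγ₁, fun F γ hγ hle b₀ p₀ κ j₀ prm η hb₀ hp₀ hadm hκ hη0 hηs hηs2 hηt => ?_⟩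
  obtain ⟨θ, C, w₀, ε, εd, δ, j₁, hθ, hC, hw₀, hεδ, hεs, hεds, hδs, hDs, hD0, hj₀₁, hstep⟩ :=
    H F γ hγ hle b₀ p₀ κ j₀ prm η hb₀ hp₀ hadm hκ hη0 hηs hηs2 hηt
  refine ⟨θ, C, w₀, ε, fun n => εd (n + 1), δ, j₁, hθ, hC, hw₀,
    fun k => ⟨(hεδ k).1, (hεδ (k + 1)).2.1, (hεδ k).2.2⟩, hεs, (summable_nat_add_iff 1).mpr hεds, hδs, hDs, hD0,
    hj₀₁, ?_⟩
  intro T μ μ' ρ ρ' hprob hcons hcl j hj hjT c a w ha hw hside hdat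
  obtain ⟨c', a', w', ha', hw', hV', hd'⟩ :=
    hstep T μ μ' ρ ρ' hprob hcons hcl j hj (by omega) c a w ha hw hside hdat
  have hidx : T - (j + 2) + 1 = T - (j + 1) := by omega
  refine ⟨c', a', w', ha', hw', ?_, hd'⟩
  simpa only [hidx] using hV'

/-! ## R2: the chain with a super-top (O1 verbatim) -/

/-- **FC, repair R2.** `OneStepContractionRun → BackwardStabilityFinSup`: with the towers' data available up to `Tt > T`, the typed
two-height organ consumes the seed at `T` (depth `Tt − (T+1) ≥ 0`); chain by `finiteChain_core` with losses `ε i + εd (Tt − (i+2))`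
(each depth once, total `≤ Σ'ε + Σ'εd`), termination by `osc_of_datum` as in R1. [folklore] -/
theorem finiteChain_sup : OneStepContractionRun → BackwardStabilityFinSup := by
  classical
  rintro ⟨γ₁, hγ₁, H⟩
  refine ⟨min γ₁ 1, lt_min hγ₁ one_pos, ?_⟩
  intro F γ hγ hle b₀ p₀ κ j₀ prm η hb₀ hp₀ hadm hκ hη0 hηs hηs2 hηt
  have hγ₁' : γ ≤ γ₁ := hle.trans (min_le_left _ _)
  have hγ1 : γ ≤ 1 := hle.trans (min_le_right _ _)
  obtain ⟨θ, C, w₀, ε, εd, δ, j₁, hθ, hC, hw₀, hεδ, hεs, hεds, hδs, hDs, hD0, hj₀₁, hstep⟩ :=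
    H F γ hγ hγ₁' b₀ p₀ κ j₀ prm η hb₀ hp₀ hadm hκ hη0 hηs hηs2 hηt
  obtain ⟨j₂, hj₂⟩ := exists_threshold_height F hγ hγ1 hb₀ hθ p₀
  have hite : HasSum (fun k : ℕ => if k = 0 then Real.log 2 else 0) (Real.log 2) := hasSum_ite_eq 0 _
  have hlog2 : 0 < Real.log 2 := Real.log_pos one_lt_two
  refine ⟨θ / b₀ ^ 2, C, w₀, fun k => ε k + εd k + (if k = 0 then Real.log 2 else 0), δ, max j₁ j₂,
    by positivity, hC, hw₀, fun k => ⟨?_, (hεδ k).2.2⟩, (hεs.add hεds).add hite.summable, hδs, hDs, hD0,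
    hj₀₁.trans (le_max_left _ _), ?_⟩
  · have h1 := (hεδ k).1
    have h2 := (hεδ k).2.1
    have h3 : (0 : ℝ) ≤ (if k = 0 then Real.log 2 else 0) := by split_ifs <;> linarith
    show 0 ≤ ε k + εd k + (if k = 0 then Real.log 2 else 0)
    linarith
  intro T Tt ωT hTt hωT μ μ' ρ ρ' hprob hcons hcl hseed j hj hjT hsmall hquad b U V hU hV hUV
  have hj₁ : j₁ ≤ j := (le_max_left _ _).trans hj
  have hj₂' : j₂ ≤ j := (le_max_right _ _).trans hj
  -- the total loss `E` and the factor `2 = e^{log 2}`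
  set E : ℝ := ∑' k, ε k + ∑' k, εd k with hEdef
  have hsumε' : ∑' k, (ε k + εd k + (if k = 0 then Real.log 2 else 0)) = E + Real.log 2 := by
    rw [(hεs.add hεds).tsum_add hite.summable, hεs.tsum_add hεds, hite.tsum_eq]
  have hexpE : Real.exp ((E + Real.log 2) + 1) = Real.exp (E + 1) * 2 := by
    rw [show (E + Real.log 2) + 1 = (E + 1) + Real.log 2 by ring, Real.exp_add, Real.exp_log two_pos]
  have hexp_le : Real.exp (E + 1) ≤ Real.exp ((E + Real.log 2) + 1) := Real.exp_le_exp.mpr (by linarith)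
  have hG : 0 < Real.exp (E + 1) := Real.exp_pos _
  simp only [hsumε'] at hsmall hquad ⊢
  -- marginal weights
  have hm0 : ∀ i, 0 ≤ θ / ((F.L : ℝ) ^ i / γ * θBal F.L γ b₀ p₀ i ^ 2) := fun i => by positivity
  have hmj : 0 < θ / ((F.L : ℝ) ^ j / γ * θBal F.L γ b₀ p₀ j ^ 2) := by
    have hθB := T3MinimiserStabilityReduction.θBal_pos (L := F.L) F.hL.2.le hγ hγ1 hb₀ p₀ j
    have hL0 : (0 : ℝ) < F.L := by exact_mod_cast (zero_lt_one.trans F.hL.2)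
    exact div_pos hθ (mul_pos (div_pos (pow_pos hL0 j) hγ) (pow_pos hθB 2))
  have hmT : θ / ((F.L : ℝ) ^ T / γ * θBal F.L γ b₀ p₀ T ^ 2) ≤ θ / b₀ ^ 2 :=
    marginalWeight_le F hγ hγ1 hb₀ hp₀ hθ.le T
  set B : ℝ := θ / ((F.L : ℝ) ^ T / γ * θBal F.L γ b₀ p₀ T ^ 2) * ωT with hBdef
  have hB0 : 0 ≤ B := mul_nonneg (hm0 T) hωT
  have hBle : B ≤ θ / b₀ ^ 2 * ωT := mul_le_mul_of_nonneg_right hmT hωT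
  have hθ' : 0 < θ / b₀ ^ 2 := by positivity
  have hDt0 : 0 ≤ ∑' k, δ (k + j) := tsum_nonneg fun k => (hεδ _).2.2
  have hDD0 : 0 ≤ ∑' i, ∑' k, δ (k + (i + j)) := tsum_nonneg fun i => tsum_nonneg fun k => (hεδ _).2.2
  -- the reflected loss sum: the depths `Tt − (k+2)`, `k ∈ [j, T)`, are distinct and `≥ Tt − 1 − T`
  have hEsum : ∑ k ∈ Finset.Ico j T, (ε k + εd (Tt - (k + 2))) ≤ E := by
    rw [Finset.sum_add_distrib]
    refine add_le_add (hεs.sum_le_tsum _ fun k _ => (hεδ k).1) ?_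
    have hsub : Finset.Ico j T ⊆ Finset.Ico j (Tt - 1) := Finset.Ico_subset_Ico le_rfl (by omega)
    calc ∑ k ∈ Finset.Ico j T, εd (Tt - (k + 2))
        = ∑ k ∈ Finset.Ico j T, εd ((Tt - 1) - (k + 1)) :=
          Finset.sum_congr rfl fun k _ => by congr 1; omega
      _ ≤ ∑ k ∈ Finset.Ico j (Tt - 1), εd ((Tt - 1) - (k + 1)) :=
          Finset.sum_le_sum_of_subset_of_nonneg hsub fun k _ _ => (hεδ _).2.1
      _ ≤ ∑' n, εd n := sum_Ico_reflect_le_tsum (fun n => (hεδ n).2.1) hεds j (Tt - 1)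
  -- the two smallness conditions in the chain's currency
  have hsmall' : Real.exp (E + 1) * (B + ∑' k, δ (k + j)) ≤ w₀ :=
    le_trans (mul_le_mul hexp_le (by linarith) (by linarith) (Real.exp_pos _).le) hsmall
  have hquad' : C * (Real.exp (E + 1) * (((T - j : ℕ) : ℝ) * B + ∑' i, ∑' k, δ (k + (i + j)))) ≤ 1 := by
    have hTj : ((T - j : ℕ) : ℝ) ≤ (T : ℝ) := by exact_mod_cast Nat.sub_le T j
    have h1 : ((T - j : ℕ) : ℝ) * B ≤ (T : ℝ) * (θ / b₀ ^ 2 * ωT) :=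
      mul_le_mul hTj hBle hB0 (Nat.cast_nonneg _)
    have h2 : Real.exp (E + 1) * (((T - j : ℕ) : ℝ) * B + ∑' i, ∑' k, δ (k + (i + j))) ≤
        Real.exp ((E + Real.log 2) + 1) * ((T : ℝ) * (θ / b₀ ^ 2 * ωT) + ∑' i, ∑' k, δ (k + (i + j))) :=
      mul_le_mul hexp_le (by linarith) (by positivity) (Real.exp_pos _).le
    exact le_trans (mul_le_mul_of_nonneg_left h2 hC) hquad
  -- the chain (the organ is applied with its top `Tt`; the step `i+1 → i` needs `i + 2 ≤ Tt`, i.e. `i + 1 ≤ T < Tt`)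
  obtain ⟨a, w, ha, hw, hVle, c, hcB, h4⟩ := finiteChain_core
    (fun i a w => ∃ c : Plaq (F.P i) 0 → ℝ, (∀ p, |c p| ≤ a) ∧ (∀ (b b' : PBond (F.P i) 0) U V W Z, PlaqSmall (θBal F.L γ b₀ p₀ i) U → PlaqSmall (θBal F.L γ b₀ p₀ i) V → PlaqSmall (θBal F.L γ b₀ p₀ i) W → PlaqSmall (θBal F.L γ b₀ p₀ i) Z → (∀ e, e ≠ b → U e = V e) → (∀ e, e ≠ b' → U e = W e) → (∀ e, e ≠ b' → V e = Z e) → (∀ e, e ≠ b → W e = Z e) → |(Real.log (ρ i U) - Real.log (ρ' i U) - ((F.L : ℝ) ^ i / γ) * ∑ p, c p * (1 - reTr (GaugeField.plaqHol U p))) - (Real.log (ρ i V) - Real.log (ρ' i V) - ((F.L : ℝ) ^ i / γ) * ∑ p, c p * (1 - reTr (GaugeField.plaqHol V p))) - ((Real.log (ρ i W) - Real.log (ρ' i W) - ((F.L : ℝ) ^ i / γ) * ∑ p, c p * (1 - reTr (GaugeField.plaqHol W p))) - (Real.log (ρ i Z) - Real.log (ρ' i Z) - ((F.L : ℝ) ^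 i / γ) * ∑ p, c p * (1 - reTr (GaugeField.plaqHol Z p))))| ≤ w * Real.exp (-(κ * (b.src.tdist b'.src : ℝ)))))
    (fun i => θ / ((F.L : ℝ) ^ i / γ * θBal F.L γ b₀ p₀ i ^ 2))
    (fun i => ε i + εd (Tt - (i + 2))) δ C w₀ B E j T
    hm0 (fun i => add_nonneg (hεδ i).1 (hεδ _).2.1) (fun i => (hεδ i).2.2) hC hB0 hδs hDs hEsum hjT
    ⟨0, ωT, le_rfl, hωT, by simp [hBdef], fun _ => 0, fun p => by simp, by
      intro b₁ b₂ U₁ V₁ W₁ Z₁ hU₁ hV₁ hW₁ hZ₁ h₁ h₂ h₃ h₄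
      simp only [zero_mul, Finset.sum_const_zero, mul_zero, sub_zero]
      exact hseed b₁ b₂ U₁ V₁ W₁ Z₁ hU₁ hV₁ hW₁ hZ₁ h₁ h₂ h₃ h₄⟩
    (by
      intro i hji hiT a w ha hw hside hD
      obtain ⟨c, hcB, h4⟩ := hD
      obtain ⟨c', a', w', ha', hw', hV', hcB', h4'⟩ :=
        hstep Tt μ μ' ρ ρ' hprob hcons hcl i (hj₁.trans hji) (by omega) c a w ha hw hside ⟨hcB, h4⟩
      refine ⟨a', w', ha', hw', ?_, c', hcB', h4'⟩
      linarith [hV'])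
    hsmall' hquad'
  -- termination at height `j`
  have hW0 : 0 ≤ Real.exp (E + 1) * (B + ∑' k, δ (k + j)) := mul_nonneg hG.le (add_nonneg hB0 hDt0)
  have hosc := osc_of_datum F (ρ j) (ρ' j) c ha hw hγ hκ.le hθ' hW0 hmj hVle (hj₂ j hj₂') hcB h4 b U V hU hV hUV
  have hX0 : 0 ≤ 1 / (θ / b₀ ^ 2) + 2 * ((F.L : ℝ) ^ j / γ) * (Fintype.card (Plaq (F.P j) 0) : ℝ) := by positivity
  refine hosc.trans ?_
  rw [hexpE]
  have h2W : 2 * (Real.exp (E + 1) * (B + ∑' k, δ (k + j))) ≤ Real.exp (E + 1) * 2 * (θ / b₀ ^ 2 * ωT + ∑' k, δ (k + j)) := by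
    have := mul_le_mul_of_nonneg_left (add_le_add_right hBle (∑' k, δ (k + j))) hG.le
    linarith
  exact mul_le_mul_of_nonneg_right h2W hX0
end Summit.QuantumFields.YangMills.Theorems.FluctuationComparisonRegPrIntL.RunPairOrgan
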